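import Summits.Ventures.PercRepro.RankLevelSetExplicitLin2Key

/-!
# PercRepro — THE GENERIC INTEGER KEY OF `(P_d)` AND THE LEVEL FROM ANY KEY ROW (p9, S4)

`proofs/SUBCLAIM-S4-p9.md` §S4.2⁗‴. The integer key `KeyP` (RankLevelSetExplicitLin2Key) is `(P_d)` with the saturated
weights `W·μ ≤ 2^μ` of the linear multiplicity. Here the key is made generic in the weight certificates:
`KeyG q p d cs Ds cb Db` is `(P_d)` with `W_s·Ds ≤ cs·2^{μ_s}`, `W_b·Db ≤ cb·2^{μ_b}` and the denominators `6·Ds·Db`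
cleared (`poly_of_keyG`); it is monotone in the rank for every `p`-independent certificate (`keyG_succ`, `keyG_mono`:
the four ratio steps of `keyP_succ`). The level assembly `c025_level_succ_of_key_row` takes ANY key predicate `K p d`
with a monotonicity law and a core law (the tail `2d + 3(q+1) + 5 ≤ p` per corank) — the cubic and quartic keys
(`cs = cb = 24`, `D = μ(μ+1)(μ+2)`; `cs = cb = 192`, `D = μ(μ+1)(μ+2)(μ+3)`) are its instances
(RankLevelSetExplicitLin2KeyCube / …KeyQuart). Axioms: standard.
-/

open scoped Matroid

namespace PercRepro

namespace ThmN

open Set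

variable {α : Type}

namespace Explicit

/-- **THE GENERIC INTEGER KEY OF `(P_d)`** at `(q, p, d)` with the weight certificates `W_s·Ds ≤ cs·2^{μ_s}`,
`W_b·Db ≤ cb·2^{μ_b}` (`μ_s = min (5·2^{q−4} − q) d`, `μ_b = min (5·2^{q−3} − q − 1) d`, `6A ≤ A6`,
`B ≤ C((q+3)d + 2q − 2, q)`) and the denominators `6·Ds·Db` cleared:
`8·(C(p+d, q)·6DsDb + cs·2^{μ_s}·Db·A6 + 6·cb·2^{μ_b}·Ds·C((q+3)d + 2q − 2, q)) ≤ 7·2^{d−q}·C(p+q, q)·6DsDb`.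
The saturated key `KeyP` is the case `cs = cb = 1`, `Ds = μ_s`, `Db = μ_b`; the cubic key takes `cs = cb = 24`,
`D = μ(μ+1)(μ+2)`; the quartic key `cs = cb = 192`, `D = μ(μ+1)(μ+2)(μ+3)`. -/
abbrev KeyG (q p d cs Ds cb Db : ℕ) : Prop :=
  8 * (chooseD (p + d) q * (6 * Ds * Db) +
      cs * 2 ^ (min (5 * 2 ^ (q - 4) - q) d) * Db * A6D q p d +
      6 * cb * 2 ^ (min (5 * 2 ^ (q - 3) - q - 1) d) * Ds * chooseD ((q + 3) * d + 2 * q - 2) q) ≤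
    7 * 2 ^ (d - q) * chooseD (p + q) q * (6 * Ds * Db)

/-- **`KeyG` IS MONOTONE IN THE RANK** for every `p`-independent certificate: `KeyG q p d … → KeyG q (p + 1) d …` for
`q ≤ d` (the four ratio steps of `keyP_succ`: every `p`-dependent factor of the left side is a binomial `C(n, j)`,
`j ≤ q`, `n ≥ p + q`, growing by at most the factor `(p + q + 1)/(p + 1)` of `C(p + q, q)`). -/
theorem keyG_succ (q p d cs Ds cb Db : ℕ) (hd : q ≤ d) (h : KeyG q p d cs Ds cb Db) :
    KeyG q (p + 1) d cs Ds cb Db := by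
  unfold KeyG A6D at h ⊢
  simp only [chooseD_eq] at h ⊢
  set μs := min (5 * 2 ^ (q - 4) - q) d with hμs
  set μb := min (5 * 2 ^ (q - 3) - q - 1) d with hμb
  set CY := ((q + 3) * d + 2 * q - 2).choose q with hCY
  set C4 := (2 * d + 2 * q - 2).choose 4 with hC4
  have e1 : p + 1 + d = p + d + 1 := by ring
  rw [e1]
  have e4 : 2 * d + 2 * q - 6 + (p + d + 1) = 2 * d + 2 * q - 6 + (p + d) + 1 := by omega
  rw [e4]
  have h1 := choose_succ_ratio (p + d) p q q le_rfl (by omega)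
  have h2 := choose_succ_ratio (p + d) p q (q - 2) (by omega) (by omega)
  have h3 := choose_succ_ratio (p + d) p q (q - 3) (by omega) (by omega)
  have h4 := choose_succ_ratio (2 * d + 2 * q - 6 + (p + d)) p q (q - 4) (by omega) (by omega)
  have hR : (p + q).choose q * (p + q + 1) = (p + 1 + q).choose q * (p + 1) := by
    have := Nat.choose_mul_succ_eq (p + q) q
    rw [show p + q + 1 - q = p + 1 by omega] at this
    rw [show p + 1 + q = p + q + 1 by ring]
    exact this
  have hpos : 0 < p + 1 := by omega
  apply Nat.le_of_mul_le_mul_right _ hpos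
  calc 8 * ((p + d + 1).choose q * (6 * Ds * Db) +
        cs * 2 ^ μs * Db * (3 * (d * (d + 1)) * (p + d + 1).choose (q - 2) +
          2 * (d * (d + 1) * (d + 2)) * (p + d + 1).choose (q - 3) +
          6 * (C4 * (2 * d + 2 * q - 6 + (p + d) + 1).choose (q - 4))) +
        6 * cb * 2 ^ μb * Ds * CY) * (p + 1)
      = 8 * ((6 * Ds * Db) * ((p + 1) * (p + d + 1).choose q) +
        cs * 2 ^ μs * Db * (3 * (d * (d + 1)) * ((p + 1) * (p + d + 1).choose (q - 2)) +
          2 * (d * (d + 1) * (d + 2)) * ((p + 1) * (p + d + 1).choose (q - 3)) +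
          6 * (C4 * ((p + 1) * (2 * d + 2 * q - 6 + (p + d) + 1).choose (q - 4)))) +
        6 * cb * 2 ^ μb * Ds * CY * (p + 1)) := by ring
    _ ≤ 8 * ((6 * Ds * Db) * ((p + q + 1) * (p + d).choose q) +
        cs * 2 ^ μs * Db * (3 * (d * (d + 1)) * ((p + q + 1) * (p + d).choose (q - 2)) +
          2 * (d * (d + 1) * (d + 2)) * ((p + q + 1) * (p + d).choose (q - 3)) +
          6 * (C4 * ((p + q + 1) * (2 * d + 2 * q - 6 + (p + d)).choose (q - 4)))) +
        6 * cb * 2 ^ μb * Ds * CY * (p + q + 1)) := by gcongr; omega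
    _ = (8 * ((p + d).choose q * (6 * Ds * Db) +
        cs * 2 ^ μs * Db * (3 * (d * (d + 1)) * (p + d).choose (q - 2) +
          2 * (d * (d + 1) * (d + 2)) * (p + d).choose (q - 3) +
          6 * (C4 * (2 * d + 2 * q - 6 + (p + d)).choose (q - 4))) +
        6 * cb * 2 ^ μb * Ds * CY)) * (p + q + 1) := by ring
    _ ≤ 7 * 2 ^ (d - q) * (p + q).choose q * (6 * Ds * Db) * (p + q + 1) := Nat.mul_le_mul_right _ h
    _ = 7 * 2 ^ (d - q) * (6 * Ds * Db) * ((p + q).choose q * (p + q + 1)) := by ring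
    _ = 7 * 2 ^ (d - q) * (6 * Ds * Db) * ((p + 1 + q).choose q * (p + 1)) := by rw [hR]
    _ = 7 * 2 ^ (d - q) * (p + 1 + q).choose q * (6 * Ds * Db) * (p + 1) := by ring

/-- **`KeyG` AT `p₀` GIVES `KeyG` AT EVERY `p ≥ p₀`** (`q ≤ d`). -/
theorem keyG_mono (q d cs Ds cb Db p₀ p : ℕ) (hd : q ≤ d) (hp : p₀ ≤ p) (h : KeyG q p₀ d cs Ds cb Db) :
    KeyG q p d cs Ds cb Db := by
  induction p, hp using Nat.le_induction with
  | base => exact h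
  | succ p _ ih => exact keyG_succ q p d cs Ds cb Db hd ih

/-- **THE GENERIC KEY GIVES `(P_d)`**: `KeyG q p d cs Ds cb Db` implies the assembled inequality for every `A`, `B`,
`W_s`, `W_b` with `W_s·Ds ≤ cs·2^{μ_s}`, `W_b·Db ≤ cb·2^{μ_b}` (`Ds, Db > 0`), `6A ≤ A6`, `B ≤ C((q+3)d + 2q − 2, q)`. -/
theorem poly_of_keyG (q p d cs Ds cb Db : ℕ) (hDs : 0 < Ds) (hDb : 0 < Db) (hkey : KeyG q p d cs Ds cb Db)
    (A B : ℕ) (Ws Wb : ℚ)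
    (hWs : Ws * (Ds : ℚ) ≤ (cs : ℚ) * 2 ^ (min (5 * 2 ^ (q - 4) - q) d))
    (hWb : Wb * (Db : ℚ) ≤ (cb : ℚ) * 2 ^ (min (5 * 2 ^ (q - 3) - q - 1) d))
    (hA : 6 * A ≤ 3 * (d * (d + 1)) * (p + d).choose (q - 2) + 2 * (d * (d + 1) * (d + 2)) * (p + d).choose (q - 3) +
        6 * ((2 * d + 2 * q - 2).choose 4 * (2 * d + 2 * q - 6 + (p + d)).choose (q - 4)))
    (hB : B ≤ ((q + 3) * d + 2 * q - 2).choose q) :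
    8 * (((p + d).choose q : ℚ) + Ws * A + Wb * B) ≤ 7 * 2 ^ (d - q) * ((p + q).choose q : ℚ) := by
  unfold KeyG A6D at hkey
  simp only [chooseD_eq] at hkey
  set μs := min (5 * 2 ^ (q - 4) - q) d with hμs
  set μb := min (5 * 2 ^ (q - 3) - q - 1) d with hμb
  set A6 := 3 * (d * (d + 1)) * (p + d).choose (q - 2) + 2 * (d * (d + 1) * (d + 2)) * (p + d).choose (q - 3) +
      6 * ((2 * d + 2 * q - 2).choose 4 * (2 * d + 2 * q - 6 + (p + d)).choose (q - 4)) with hA6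
  set CY := ((q + 3) * d + 2 * q - 2).choose q with hCY
  set C1 := (p + d).choose q with hC1
  set C2 := (p + q).choose q with hC2
  have hk : (8 : ℚ) * ((C1 : ℚ) * (6 * Ds * Db) + cs * 2 ^ μs * Db * A6 + 6 * cb * 2 ^ μb * Ds * CY) ≤
      7 * 2 ^ (d - q) * C2 * (6 * Ds * Db) := by exact_mod_cast hkey
  have hAq : (6 * A : ℚ) ≤ A6 := by exact_mod_cast hA
  have hBq : (B : ℚ) ≤ CY := by exact_mod_cast hB
  have hDsq : (0 : ℚ) < Ds := by exact_mod_cast hDs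
  have hDbq : (0 : ℚ) < Db := by exact_mod_cast hDb
  have hA0 : (0 : ℚ) ≤ A := Nat.cast_nonneg _
  have hB0 : (0 : ℚ) ≤ B := Nat.cast_nonneg _
  have hcs0 : (0 : ℚ) ≤ cs := Nat.cast_nonneg _
  have hcb0 : (0 : ℚ) ≤ cb := Nat.cast_nonneg _
  have h1 : Ws * A * (6 * Ds * Db) ≤ cs * 2 ^ μs * Db * A6 := by
    calc Ws * A * (6 * Ds * Db) = (Ws * Ds) * ((6 * A) * Db) := by ring
      _ ≤ cs * 2 ^ μs * ((6 * A) * Db) := mul_le_mul_of_nonneg_right hWs (by positivity)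
      _ ≤ cs * 2 ^ μs * (A6 * Db) := by gcongr
      _ = cs * 2 ^ μs * Db * A6 := by ring
  have h2 : Wb * B * (6 * Ds * Db) ≤ 6 * cb * 2 ^ μb * Ds * CY := by
    calc Wb * B * (6 * Ds * Db) = (Wb * Db) * (B * (6 * Ds)) := by ring
      _ ≤ cb * 2 ^ μb * (B * (6 * Ds)) := mul_le_mul_of_nonneg_right hWb (by positivity)
      _ ≤ cb * 2 ^ μb * (CY * (6 * Ds)) := by gcongr
      _ = 6 * cb * 2 ^ μb * Ds * CY := by ring
  have hpos : (0 : ℚ) < 6 * Ds * Db := by positivity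
  have hmain : 8 * ((C1 : ℚ) + Ws * A + Wb * B) * (6 * Ds * Db) ≤ 7 * 2 ^ (d - q) * (C2 : ℚ) * (6 * Ds * Db) := by
    have e : 8 * ((C1 : ℚ) + Ws * A + Wb * B) * (6 * Ds * Db) =
        8 * ((C1 : ℚ) * (6 * Ds * Db) + Ws * A * (6 * Ds * Db) + Wb * B * (6 * Ds * Db)) := by ring
    rw [e]
    linarith
  exact le_of_mul_le_mul_right hmain hpos

end Explicit

/-- A key predicate at `p₀` holds at every `p ≥ p₀` once it is monotone step by step. -/
theorem key_mono_of_succ (K : ℕ → ℕ → Prop) (d : ℕ) (hmono : ∀ p, K p d → K (p + 1) d) (p₀ p : ℕ)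
    (hp : p₀ ≤ p) (h : K p₀ d) : K p d := by
  induction p, hp using Nat.le_induction with
  | base => exact h
  | succ p _ ih => exact hmono p ih

/-- **THE LEVEL FROM ONE EVALUATED ROW OF ANY KEY**: level `q + 1 ≥ 8` for EVERY finite matroid and every `p ≥ p₀` from
(i) level `q` for every `p ≥ p₀ − 1`, (ii) a key predicate `K p d` (at level `q + 1`) that is monotone in `p` (`hmono`) and
closes the `e`-free core cell `(p, d)` for `q + 2 ≤ d ≤ q + 1 + 2^{q+1}` under the tail `2d + 3(q+1) + 5 ≤ p` (`hcore`),
(iii) the evaluated row `K p₀ d` at every core corank, (iv) `p₀ ≥ N₁(q + 1)` (the large-corank theorem for the coranks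
`> q + 1 + 2^{q+1}`) and the tail at the largest core corank `2(q + 1 + 2^{q+1}) + 3(q+1) + 5 ≤ p₀`; at corank `≤ q + 1`
the level is free (`U = ∅`, Theorem M). The wrapper is `rls_succ_large_at`, rank by rank. -/
theorem c025_level_succ_of_key_row (q : ℕ) (hq : 7 ≤ q) (p₀ : ℕ) (K : ℕ → ℕ → Prop)
    (hN : 2 ^ (q + 1 + 1) + 2 * (q + 1) ^ 2 + 4 * (q + 1) + 4 ≤ p₀)
    (htail : 2 * (q + 1 + 2 ^ (q + 1)) + 3 * (q + 1) + 5 ≤ p₀)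
    (hmono : ∀ p d, q + 1 ≤ d → K p d → K (p + 1) d)
    (hcore : ∀ (M : Matroid α) [M.Finite] (p d : ℕ), q + 2 ≤ d → d ≤ q + 1 + 2 ^ (q + 1) →
      2 * d + 3 * (q + 1) + 5 ≤ p → K p d → M.eRank = (p : ℕ∞) → M.E.ncard = p + d →
      (∀ e ∈ M.E, ∃ A ⊆ M.E \ {e}, e ∉ M.closure A ∧ e ∉ M.closure ((M.E \ {e}) \ A)) → RLS M p (q + 1))
    (hrow : ∀ t < 2 ^ (q + 1), K p₀ (q + 2 + t))
    (hprev : ∀ (M : Matroid α) [M.Finite] (p : ℕ), p₀ - 1 ≤ p → RLS M p q) :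
    ∀ (M : Matroid α) [M.Finite] (p : ℕ), p₀ ≤ p → RLS M p (q + 1) := by
  intro M _ p hp
  have h2q : 2 ≤ 2 ^ (q + 1 + 1) := by
    calc 2 = 2 ^ 1 := by norm_num
      _ ≤ 2 ^ (q + 1 + 1) := Nat.pow_le_pow_right (by norm_num) (by omega)
  refine rls_succ_large_at (α := α) q (q + 1) p (by omega) (fun M' _ => hprev M' (p - 1) (by omega)) ?_ ?_ M
  · -- corank `≤ q + 1`: `U = ∅` or Theorem M
    intro M' _ hn
    rcases Nat.lt_or_ge M'.E.ncard (p + (q + 1)) with h | h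
    · exact RLS_of_ncard_lt M' h
    · exact RLS_of_ncard_eq M' (by omega)
  · -- the core at level `q + 1`, corank `d ≥ q + 2`
    intro M' _ hR hbig hfree
    rcases Nat.lt_or_ge M'.E.ncard (p + (q + 1) + 2 ^ (q + 1) + 1) with h | h
    · have hkey0 := hrow (M'.E.ncard - p - (q + 2)) (by omega)
      rw [show q + 2 + (M'.E.ncard - p - (q + 2)) = M'.E.ncard - p by omega] at hkey0
      have hkey := key_mono_of_succ K (M'.E.ncard - p) (fun p' => hmono p' (M'.E.ncard - p) (by omega)) p₀ p hp hkey0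
      exact hcore M' p (M'.E.ncard - p) (by omega) (by omega) (by omega) hkey hR (by omega) hfree
    · exact c025_core_explicit_large' (q + 1) (by omega) M' p (by omega) hR (by omega) hfree

end ThmN

end PercRepro
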